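import Summits.CriticalPhenomena.PercolationContinuityZ3.Theorems.PercNearOneGluingNoHeavyLowerTailFKPhiMassBridge
import Summits.CriticalPhenomena.PercolationContinuityZ3.Theorems.PercNearOneGluingNoHeavyLowerTailFKStarHLayer
import Literature.Probability.LatticeModels.RandomClusterEdgeWeightsConditioning
import HarnessLib

/-!
# FK sub-lane: the TV-BOUND — the `K`-gain outside `C_Y` is at most the total `K`-gain (`q ≥ 1`)

Support file (`--supports stmt-CriticalPhenomena-4575`), FK sub-lane `prim-bschramm-fk-2` (gen 4); builds on p205010 (kernel theorem,
internal audit signed; external expert review pending).  No definitions, no named facts, no sorries; standard axioms.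

The base inequality of fk-2 gen 4's proof of Lemma Φ(b)_FK (`FK.PhiFKMonotone`, bschramm/FK-Q2.md §13):
  **`FK.phiFK_le_totalGain`**: for `q ≥ 1`, every parameter vector with parameters `< 1` on the pairs meeting `K`, every owner `x`,
  avoided set `Y` and monotone `g`,   `Φ_FK(K) ≤ E_{φ_w}[g(C_x)] − E_{φ_{w−K̄}}[g(C_x)]`.
PROOF.  With `F̂ := E_{φ_w}[g(C_x) | σ(C_Y)]`: `F̂ = phiD + g(C_x)` on the support of `φ_{w−K̄}` (on `{x ↮ Y}` the class-conditional mean is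
the world mean `E_{φ_{w − cut_Y}}[g(C_x)]` by van den Berg–Häggström–Kahn's Lemma 2.3; on `{x ↔ Y}` the cluster `C_x` is decided by `C_Y`),
and `φ_{w−K̄} = φ_w( · | all pairs meeting K closed)` (Grimmett Thm. (3.7)); so the claim is `E_w[F̂ | I_K] ≤ E_w[F̂]`, i.e.
`Cov_w(F̂, 1{some pair at K open}) ≥ 0` — GLADKOV'S TREE-HARRIS inequality along the exploration of `C_Y` for `φ_{𝐩,q}`
(`FK.setClusterHarris_rc`), first for indicator test functions (`FK.sum_phiD_ind_le`), then for every monotone `g` by the layer cake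
(`FK.layerCake_le`).  Tools: `FK.rcMass_mul_ind_allClosed` (deleting = conditioning closed, point masses), `FK.rcMeasureW_real_closed_pos`,
`FK.rcMass_ne_zero_of_delW`.
[cite: Gladkov2024, Thm. 3.2 (p. 4)] [cite: VandenbergHaggstromKahn2005, §2.1 Lemma 2.3 (p. 10)] [cite: Grimmett2006, Thm. (3.7) (p. 39), Thm. (3.8)(b)]
-/

noncomputable section

namespace Summit.CriticalPhenomena.PercolationContinuityZ3.Theorems.FK

open MeasureTheory Set Literature.Probability.LatticeModels Literature.Probability.Percolation
open Literature.Probability.Percolation.DecisionTree (ind ind_of_mem ind_of_not_mem ind_nonneg)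
open Literature.Probability.Percolation.BHK2006 (rcMass rcMass_nonneg sum_rcMass delW setCl barOf weight
  rcMeasureW_real_eq_sum_rcMass setIntegral_rcMeasureW_eq_sum integral_rcMeasureW_eq_sum rcMass_sum_setCl_eq
  delW_eq_condWeights setCl_eq_sdiff_barOf setReach_iff openEdgeCluster_mono)
open Summit.CriticalPhenomena.PercolationContinuityZ3.Theorems.HullPort (cut avoidEv cut_eq_barOf)
open scoped Classical

variable {V : Type*} [Fintype V]

/-! ### Deleting pairs = conditioning them closed (point masses) -/

omit [Fintype V] in
/-- The event "every pair of `D` is closed". [cite: Grimmett2006, Thm. (3.7) (p. 39)] -/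
theorem closedSet_eq (D : Set (Sym2 V)) :
    {ω : BondConfig V | ω \ Dᶜ = ∅} = {ω : BondConfig V | ∀ e ∈ D, e ∉ ω} := by
  ext ω
  simp only [Set.mem_setOf_eq, Set.sdiff_compl, Set.eq_empty_iff_forall_notMem, Set.mem_inter_iff, not_and]
  exact ⟨fun h e heD heω => h e heω heD, fun h e heω heD => h e heD heω⟩

/-- **Deleting the pairs of `D` is conditioning them to be closed** (Grimmett Thm. (3.7), point-mass form):
`φ_w(ω)·1{ω ∩ D = ∅} = φ_w(all of D closed)·φ_{w − D}(ω)`. [cite: Grimmett2006, Thm. (3.7) (p. 39)] -/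
theorem rcMass_mul_ind_allClosed (w : Sym2 V → unitInterval) {q : ℝ} (hq : 0 < q) (D : Set (Sym2 V)) (ω : BondConfig V) :
    rcMass w q ω * ind {ζ : BondConfig V | ∀ e ∈ D, e ∉ ζ} ω =
      (rcMeasureW w q ∅).real {ζ : BondConfig V | ∀ e ∈ D, e ∉ ζ} * rcMass (delW w D) q ω := by
  have hdisj : Disjoint (∅ : Set (Sym2 V)) Dᶜ := Set.empty_disjoint _
  have key := fun ζ => rcWeightW_mul_ind_cylinder w q ∅ hdisj ζ
  simp only [closedSet_eq, ← delW_eq_condWeights] at key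
  have hZ := rcPartitionFunctionW_pos w hq ∅
  have hZD := rcPartitionFunctionW_pos (delW w D) hq ∅
  -- the measure of the closed event
  have hI : (rcMeasureW w q ∅).real {ζ : BondConfig V | ∀ e ∈ D, e ∉ ζ} =
      offWeight w Dᶜ ∅ * rcPartitionFunctionW (delW w D) q ∅ / rcPartitionFunctionW w q ∅ := by
    rw [rcMeasureW_real_eq_sum_div w hq]
    congr 1
    rw [rcPartitionFunctionW, Finset.mul_sum]
    exact Finset.sum_congr rfl fun ζ _ => key ζ
  rw [hI]
  unfold rcMass
  rw [div_mul_eq_mul_div, key ω]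
  field_simp

/-- The closed event of `D` has positive probability when the parameters on `D` are `< 1`. [cite: Grimmett2006, Thm. (3.7) (p. 39)] -/
theorem rcMeasureW_real_closed_pos (w : Sym2 V → unitInterval) {q : ℝ} (hq : 0 < q) {D : Set (Sym2 V)}
    (hD : ∀ e ∈ D, (w e : ℝ) < 1) : 0 < (rcMeasureW w q ∅).real {ζ : BondConfig V | ∀ e ∈ D, e ∉ ζ} := by
  have hdisj : Disjoint (∅ : Set (Sym2 V)) Dᶜ := Set.empty_disjoint _
  have key := fun ζ => rcWeightW_mul_ind_cylinder w q ∅ hdisj ζ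
  simp only [closedSet_eq, ← delW_eq_condWeights] at key
  have hZ := rcPartitionFunctionW_pos w hq ∅
  have hZD := rcPartitionFunctionW_pos (delW w D) hq ∅
  have hI : (rcMeasureW w q ∅).real {ζ : BondConfig V | ∀ e ∈ D, e ∉ ζ} =
      offWeight w Dᶜ ∅ * rcPartitionFunctionW (delW w D) q ∅ / rcPartitionFunctionW w q ∅ := by
    rw [rcMeasureW_real_eq_sum_div w hq]
    congr 1
    rw [rcPartitionFunctionW, Finset.mul_sum]
    exact Finset.sum_congr rfl fun ζ _ => key ζ
  have hoff : 0 < offWeight w Dᶜ ∅ := by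
    unfold offWeight
    refine Finset.prod_pos fun e _ => ?_
    by_cases he : e ∈ Dᶜ
    · rw [if_pos he]; exact one_pos
    · rw [if_neg he, if_neg (Set.notMem_empty e)]
      exact sub_pos.2 (hD e (Set.not_notMem.1 he))
  rw [hI]
  positivity

/-- If a configuration has positive mass under `w − D` and the parameters on `D` are `< 1`, it has positive mass under `w`.
[cite: Grimmett2006, §1.4 eq. (1.20) (p. 15)] -/
theorem rcMass_ne_zero_of_delW (w : Sym2 V → unitInterval) {q : ℝ} (hq : 0 < q) {D : Set (Sym2 V)}
    (hD : ∀ e ∈ D, (w e : ℝ) < 1) {ω : BondConfig V} (h : rcMass (delW w D) q ω ≠ 0) : rcMass w q ω ≠ 0 := by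
  have hne : ∀ e, (if e ∈ ω then ((delW w D e : unitInterval) : ℝ) else 1 - (delW w D e : ℝ)) ≠ 0 := by
    intro e hzero
    apply h
    unfold rcMass rcWeightW weight
    rw [Finset.prod_eq_zero (Finset.mem_univ e) hzero, zero_mul, zero_div]
  have hne' : ∀ e, (if e ∈ ω then ((w e : unitInterval) : ℝ) else 1 - (w e : ℝ)) ≠ 0 := by
    intro e
    have h1 := hne e
    by_cases heω : e ∈ ω
    · rw [if_pos heω] at h1 ⊢
      by_cases heD : e ∈ D
      · exfalso; simp only [delW, if_pos heD] at h1; exact h1 (by simp)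
      · simpa only [delW, if_neg heD] using h1
    · rw [if_neg heω] at h1 ⊢
      by_cases heD : e ∈ D
      · exact (sub_pos.2 (hD e heD)).ne'
      · simpa only [delW, if_neg heD] using h1
  unfold rcMass rcWeightW weight
  refine div_ne_zero (mul_ne_zero (Finset.prod_ne_zero_iff.2 fun e _ => hne' e) (pow_ne_zero _ hq.ne')) ?_
  exact (rcPartitionFunctionW_pos w hq ∅).ne'

/-! ### The TV-bound for indicator test functions: tree-Harris along the exploration of `C_Y` -/

/-- **The `K`-gain outside `C_Y` is at most the total `K`-gain — indicator test functions.**  For `q ≥ 1`, parameters `< 1` on the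
pairs meeting `K`, and an increasing family `U` of edge sets,
`Σ_ω φ_{G−K̄}(ω)·phiD_{1_U}(ω) ≤ φ_G(C_x ∈ U) − φ_{G−K̄}(C_x ∈ U)`.
Proof: with `F̂ = φ_G(C_x ∈ U | σ(C_Y))`, Gladkov's tree-Harris along the exploration of `C_Y` (`FK.setClusterHarris_rc`) gives
`Cov_G(F̂, 1{some pair at K open}) ≥ 0`, i.e. `E_{G−K̄}[F̂] ≤ E_G[F̂] = φ_G(C_x ∈ U)` (deleting `K̄` = conditioning on the decreasing
event "all pairs at `K` closed", Grimmett Thm. (3.7)); and `F̂ = phiD_{1_U} + 1{C_x ∈ U}` pointwise on the support of `φ_{G−K̄}`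
(van den Berg–Häggström–Kahn's Lemma 2.3 on `{x ↮ Y}`; class-constancy of `C_x` on `{x ↔ Y}`).
[cite: Gladkov2024, Thm. 3.2 (p. 4)] [cite: VandenbergHaggstromKahn2005, §2.1 Lemma 2.3 (p. 10)] [cite: Grimmett2006, Thm. (3.7) (p. 39), Thm. (3.8)(b)] -/
theorem sum_phiD_ind_le (w : Sym2 V → unitInterval) {q : ℝ} (hq : 1 ≤ q) (x : V) (Y K : Set V)
    (hK1 : ∀ e ∈ CSH.edgesOf K, (w e : ℝ) < 1) (U : Set (Set (Sym2 V))) (hU : IsUpperSet U) :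
    ∑ ω, rcMass (delW w (CSH.edgesOf K)) q ω * phiD w q x Y (fun C => ind U C) ω ≤
      (∑ ζ, rcMass w q ζ * ind U (openEdgeCluster ζ x)) - ∑ ζ, rcMass (delW w (CSH.edgesOf K)) q ζ * ind U (openEdgeCluster ζ x) := by
  classical
  have hq0 : 0 < q := one_pos.trans_le hq
  haveI := isProbabilityMeasure_rcMeasureW w hq0 (∅ : Set V)
  set D : Set (Sym2 V) := CSH.edgesOf K with hD
  set wK : Sym2 V → unitInterval := delW w D with hwK
  set A : Set (BondConfig V) := {η : BondConfig V | openEdgeCluster η x ∈ U} with hA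
  set N : Set (BondConfig V) := {ζ : BondConfig V | ∃ e ∈ D, e ∈ ζ} with hN
  set I : Set (BondConfig V) := {ζ : BondConfig V | ∀ e ∈ D, e ∉ ζ} with hI
  set E : BondConfig V → Set (BondConfig V) := fun ω => {ζ | setCl ζ Y = setCl ω Y} with hE
  set cp : Set (BondConfig V) → BondConfig V → ℝ := fun T ω =>
    (rcMeasureW w q ∅).real (T ∩ E ω) / (rcMeasureW w q ∅).real (E ω) with hcp
  have hG : ∀ η : BondConfig V, ind U (openEdgeCluster η x) = ind A η := fun η => rfl
  have hAup : IsUpperSet A := fun ω ω' hle hω => hU (openEdgeCluster_mono hle x) hω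
  have hNup : IsUpperSet N := fun ω ω' hle ⟨e, heD, heω⟩ => ⟨e, heD, hle heω⟩
  have hmass : ∀ ω, (rcMeasureW w q ∅).real {ω} = rcMass w q ω := fun ω => by
    rw [rcMeasureW_real_singleton w hq0]; rfl
  -- tree-Harris along the exploration of `C_Y`
  have hTH : (rcMeasureW w q ∅).real A * (rcMeasureW w q ∅).real N ≤ ∑ ω, rcMass w q ω * (cp A ω * cp N ω) := by
    have h := setClusterHarris_rc w hq ∅ (Set.toFinite Y).toFinset hAup hNup
    simp only [Set.Finite.coe_toFinset, hmass] at h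
    refine le_of_le_of_eq h (Finset.sum_congr rfl fun ω _ => ?_)
    simp only [hcp, hE]; ring
  -- reindexing: `E[cp_A · cp_N] = E[cp_A · 1_N]`, `E[cp_A] = μ(A)`
  have hclass : ∀ ω ω' : BondConfig V, setCl ω' Y = setCl ω Y → cp A ω' = cp A ω := by
    intro ω ω' h
    have : E ω' = E ω := by ext ζ; simp only [hE, Set.mem_setOf_eq, h]
    simp only [hcp, this]
  have hre : ∑ ω, rcMass w q ω * (cp A ω * cp N ω) = ∑ ω, rcMass w q ω * (cp A ω * ind N ω) :=
    sum_rcMass_mul_condProb_key w hq0 (fun ζ => setCl ζ Y) N (cp A) hclass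
  have htot : ∑ ω, rcMass w q ω * cp A ω = (rcMeasureW w q ∅).real A := by
    have h := sum_rcMass_mul_condProb_key w hq0 (fun ζ => setCl ζ Y) A (fun _ => (1 : ℝ)) (fun _ _ _ => rfl)
    simp only [one_mul] at h
    rw [rcMeasureW_real_eq_sum_rcMass w hq0]
    exact h
  -- complement
  have hIN : ∀ ω, ind I ω = 1 - ind N ω := by
    intro ω
    by_cases h : ω ∈ N
    · obtain ⟨e, heD, heω⟩ := h
      have hnI : ω ∉ I := fun h' => (show ∀ e ∈ D, e ∉ ω from h') e heD heω
      rw [ind_of_mem (show ω ∈ N from ⟨e, heD, heω⟩), ind_of_not_mem hnI]; ring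
    · have hI' : ω ∈ I := show ∀ e ∈ D, e ∉ ω from fun e heD heω => h ⟨e, heD, heω⟩
      rw [ind_of_not_mem h, ind_of_mem hI']; ring
  have hμI : (rcMeasureW w q ∅).real I = 1 - (rcMeasureW w q ∅).real N := by
    rw [rcMeasureW_real_eq_sum_rcMass w hq0, rcMeasureW_real_eq_sum_rcMass w hq0]
    simp only [hIN, mul_sub, mul_one, Finset.sum_sub_distrib, sum_rcMass w hq0]
  have hSI : ∑ ω, rcMass w q ω * (cp A ω * ind I ω) ≤ (rcMeasureW w q ∅).real A * (rcMeasureW w q ∅).real I := by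
    have e1 : ∑ ω, rcMass w q ω * (cp A ω * ind I ω) =
        (∑ ω, rcMass w q ω * cp A ω) - ∑ ω, rcMass w q ω * (cp A ω * ind N ω) := by
      rw [← Finset.sum_sub_distrib]
      exact Finset.sum_congr rfl fun ω _ => by rw [hIN]; ring
    rw [e1, htot, ← hre, hμI]
    nlinarith [hTH]
  -- conditioning: the `I`-restricted mass is `μ(I)` times the mass under `w − D`
  have hcond : ∑ ω, rcMass w q ω * (cp A ω * ind I ω) = (rcMeasureW w q ∅).real I * ∑ ω, rcMass wK q ω * cp A ω := by
    rw [Finset.mul_sum]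
    refine Finset.sum_congr rfl fun ω _ => ?_
    have h := rcMass_mul_ind_allClosed w hq0 D ω
    calc rcMass w q ω * (cp A ω * ind I ω) = (rcMass w q ω * ind I ω) * cp A ω := by ring
      _ = _ := by rw [h]; ring
  have hIpos : 0 < (rcMeasureW w q ∅).real I := rcMeasureW_real_closed_pos w hq0 hK1
  have hmain : ∑ ω, rcMass wK q ω * cp A ω ≤ (rcMeasureW w q ∅).real A := by
    have := hSI; rw [hcond] at this
    nlinarith [hIpos]
  -- identification of `cp A` on the support of `w − D`
  have hid : ∀ ω, rcMass wK q ω * cp A ω = rcMass wK q ω * (phiD w q x Y (fun C => ind U C) ω + ind A ω) := by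
    intro ω
    by_cases hz : rcMass wK q ω = 0
    · rw [hz, zero_mul, zero_mul]
    congr 1
    have hw0 : rcMass w q ω ≠ 0 := rcMass_ne_zero_of_delW w hq0 hK1 hz
    have hEp : 0 < (rcMeasureW w q ∅).real (E ω) := by
      have hle : (rcMeasureW w q ∅).real {ω} ≤ (rcMeasureW w q ∅).real (E ω) :=
        measureReal_mono (Set.singleton_subset_iff.2 rfl) (measure_ne_top _ _)
      rw [hmass] at hle
      exact lt_of_lt_of_le (lt_of_le_of_ne (rcMass_nonneg w hq0 ω) (Ne.symm hw0)) hle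
    set W := setCl ω Y with hW
    have hEv : {ζ : BondConfig V | (⋃ s ∈ Y, openEdgeCluster ζ s) = W} = E ω := by
      ext ζ; simp only [hE, Set.mem_setOf_eq]; rfl
    by_cases hav : ω ∈ avoidEv x Y
    · -- `x ↮ Y`: the class-conditional probability is the world probability (Lemma 2.3)
      have hxW : ∀ t ∈ ({x} : Set V), ¬ (t ∈ Y ∨ ∃ e ∈ W, t ∈ e) := by
        intro t ht; rw [Set.mem_singleton_iff] at ht; subst ht
        exact (CSH.mem_avoidEv_iff_notMem_span t Y ω).1 hav
      have hCx : ∀ ζ, ζ ∈ E ω → openEdgeCluster ζ x = openEdgeCluster (ζ \ barOf Y W) x := by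
        intro ζ hζ
        have hζ' : setCl ζ Y = W := hζ
        have := setCl_eq_sdiff_barOf (T := {x}) hζ' hxW
        simpa [setCl] using this
      have hAeq : E ω ∩ {ζ | ζ \ barOf Y W ∈ A} = A ∩ E ω := by
        ext ζ; constructor
        · rintro ⟨h1, h2⟩
          refine ⟨?_, h1⟩
          simp only [hA, Set.mem_setOf_eq] at h2 ⊢; rwa [hCx ζ h1]
        · rintro ⟨h1, h2⟩
          refine ⟨h2, ?_⟩
          simp only [hA, Set.mem_setOf_eq] at h1 ⊢; rwa [← hCx ζ h2]
      have h23 := BHK2006_rcMeasureW_real_setCl_inter w hq0 Y W A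
      rw [hEv, hAeq] at h23
      have hcpA : cp A ω = (rcMeasureW (delW w (barOf Y W)) q ∅).real A := by
        simp only [hcp]; rw [h23]; field_simp
      have hwE : wE w q (cut Y ω) (fun η => ind U (openEdgeCluster η x)) = (rcMeasureW (delW w (barOf Y W)) q ∅).real A := by
        unfold wE
        rw [cut_eq_barOf, rcMeasureW_real_eq_sum_rcMass _ hq0]
        exact Finset.sum_congr rfl fun η _ => by simp only [hW, hG]
      unfold phiD
      rw [ind_of_mem hav, one_mul, hwE, hcpA]
      simp only [hG]
      ring
    · -- `x ↔ Y`: `C_x` is decided on the class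
      have hj : ∃ n ∈ Y, (openGraph ω).Reachable n x := by
        by_contra hc
        exact hav fun y hy hxy => hc ⟨y, hy, hxy.symm⟩
      have hconst : ∀ ζ, ζ ∈ E ω → (ζ ∈ A ↔ ω ∈ A) := by
        intro ζ hζ
        simp only [hA, Set.mem_setOf_eq]
        rw [openEdgeCluster_eq_of_setCl_eq_of_joined (show setCl ζ Y = setCl ω Y from hζ) hj]
      have hcpA : cp A ω = ind A ω := by
        simp only [hcp]
        by_cases hωA : ω ∈ A
        · have : A ∩ E ω = E ω := by
            ext ζ; exact ⟨fun h => h.2, fun h => ⟨(hconst ζ h).2 hωA, h⟩⟩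
          rw [this, ind_of_mem hωA, div_self hEp.ne']
        · have : A ∩ E ω = ∅ := Set.eq_empty_iff_forall_notMem.2 fun ζ h => hωA ((hconst ζ h.2).1 h.1)
          rw [this, ind_of_not_mem hωA, measureReal_empty, zero_div]
      unfold phiD
      rw [ind_of_not_mem hav, zero_mul, zero_add, hcpA]
  -- conclusion
  have hsum : ∑ ω, rcMass wK q ω * cp A ω =
      (∑ ω, rcMass wK q ω * phiD w q x Y (fun C => ind U C) ω) + ∑ ω, rcMass wK q ω * ind A ω := by
    rw [← Finset.sum_add_distrib]
    exact Finset.sum_congr rfl fun ω _ => by rw [hid]; ring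
  rw [hsum, rcMeasureW_real_eq_sum_rcMass w hq0] at hmain
  simp only [hG]
  linarith

/-! ### General monotone test functions by the layer cake, and the measure-level statement -/

/-- `phiD` is linear in the test function. [folklore] -/
theorem phiD_lin (w : Sym2 V → unitInterval) (q : ℝ) (x : V) (Y : Set V) (c : ℝ) (g₁ g₂ : Set (Sym2 V) → ℝ) (ω : Set (Sym2 V)) :
    phiD w q x Y (fun C => c * g₁ C + g₂ C) ω = c * phiD w q x Y g₁ ω + phiD w q x Y g₂ ω := by
  unfold phiD wE
  have e1 : ∑ η, rcMass (delW w (cut Y ω)) q η * (c * g₁ (openEdgeCluster η x) + g₂ (openEdgeCluster η x)) =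
      c * ∑ η, rcMass (delW w (cut Y ω)) q η * g₁ (openEdgeCluster η x) + ∑ η, rcMass (delW w (cut Y ω)) q η * g₂ (openEdgeCluster η x) := by
    rw [Finset.mul_sum, ← Finset.sum_add_distrib]
    exact Finset.sum_congr rfl fun η _ => by ring
  rw [e1]; ring

/-- `phiD` vanishes on constant test functions (`q > 0`). [folklore] -/
theorem phiD_const (w : Sym2 V → unitInterval) {q : ℝ} (hq : 0 < q) (x : V) (Y : Set V) (c : ℝ) (ω : Set (Sym2 V)) :
    phiD w q x Y (fun _ => c) ω = 0 := by
  unfold phiD wE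
  rw [← Finset.sum_mul, sum_rcMass _ hq, one_mul, sub_self, mul_zero]

/-- **The `K`-gain outside `C_Y` is at most the total `K`-gain** (sum form, every monotone test function): for `q ≥ 1` and parameters
`< 1` on the pairs meeting `K`, `Σ_ω φ_{G−K̄}(ω)·phiD_g(ω) ≤ E_G[g(C_x)] − E_{G−K̄}[g(C_x)]` — from the indicator case by the layer cake.
[cite: Gladkov2024, Thm. 3.2 (p. 4)] [cite: VandenbergHaggstromKahn2005, §2.1 Lemma 2.3 (p. 10)] [cite: Grimmett2006, Thm. (3.7), Thm. (3.8)(b)] -/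
theorem sum_phiD_le (w : Sym2 V → unitInterval) {q : ℝ} (hq : 1 ≤ q) (x : V) (Y K : Set V)
    (hK1 : ∀ e ∈ CSH.edgesOf K, (w e : ℝ) < 1) {g : Set (Sym2 V) → ℝ} (hg : Monotone g) :
    ∑ ω, rcMass (delW w (CSH.edgesOf K)) q ω * phiD w q x Y g ω ≤
      (∑ ζ, rcMass w q ζ * g (openEdgeCluster ζ x)) - ∑ ζ, rcMass (delW w (CSH.edgesOf K)) q ζ * g (openEdgeCluster ζ x) := by
  have hq0 : 0 < q := one_pos.trans_le hq
  refine layerCake_le (fun g' => ∑ ω, rcMass (delW w (CSH.edgesOf K)) q ω * phiD w q x Y g' ω)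
    (fun g' => (∑ ζ, rcMass w q ζ * g' (openEdgeCluster ζ x)) - ∑ ζ, rcMass (delW w (CSH.edgesOf K)) q ζ * g' (openEdgeCluster ζ x))
    ?_ ?_ ?_ ?_ ?_ g hg
  · intro c g₁ g₂
    simp only [phiD_lin, mul_add, Finset.sum_add_distrib, Finset.mul_sum]
    exact congrArg₂ (· + ·) (Finset.sum_congr rfl fun ω _ => by ring) rfl
  · intro c g₁ g₂
    have e1 : ∀ (u : Sym2 V → unitInterval), ∑ ζ, rcMass u q ζ * (c * g₁ (openEdgeCluster ζ x) + g₂ (openEdgeCluster ζ x)) =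
        c * (∑ ζ, rcMass u q ζ * g₁ (openEdgeCluster ζ x)) + ∑ ζ, rcMass u q ζ * g₂ (openEdgeCluster ζ x) := by
      intro u
      rw [Finset.mul_sum, ← Finset.sum_add_distrib]
      exact Finset.sum_congr rfl fun ζ _ => by ring
    rw [e1, e1]; ring
  · intro c
    exact Finset.sum_eq_zero fun ω _ => by rw [phiD_const w hq0, mul_zero]
  · intro c
    rw [← Finset.sum_mul, ← Finset.sum_mul, sum_rcMass _ hq0, sum_rcMass _ hq0]; ring
  · intro U hU
    exact sum_phiD_ind_le w hq x Y K hK1 U hU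

/-- **TV-BOUND: the `K`-gain outside `C_Y` is at most the total `K`-gain** — for `q ≥ 1`, every parameter vector with parameters
`< 1` on the pairs meeting `K`, every owner `x`, avoided set `Y` and monotone `g`:
`Φ_FK(K) ≤ E_{φ_w}[g(C_x)] − E_{φ_{w−K̄}}[g(C_x)]`.  The base inequality of fk-2 gen 4's proof of Lemma Φ(b)_FK (bschramm/FK-Q2.md
§13): Gladkov's tree-Harris along the exploration of `C_Y` + van den Berg–Häggström–Kahn's Lemma 2.3 + "deleting = conditioning closed".
[cite: Gladkov2024, Thm. 3.2 (p. 4)] [cite: VandenbergHaggstromKahn2005, §2.1 Lemma 2.3 (p. 10)] [cite: Grimmett2006, Thm. (3.7) (p. 39), Thm. (3.8)(b)] -/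
theorem phiFK_le_totalGain (w : Sym2 V → unitInterval) {q : ℝ} (hq : 1 ≤ q) (x : V) (Y K : Set V)
    (hK1 : ∀ e ∈ CSH.edgesOf K, (w e : ℝ) < 1) {g : Set (Sym2 V) → ℝ} (hg : Monotone g) :
    phiFK w q x Y g K ≤ (∫ η, g (openEdgeCluster η x) ∂(rcMeasureW w q ∅)) -
      ∫ η, g (openEdgeCluster η x) ∂(rcMeasureW (delW w (CSH.edgesOf K)) q ∅) := by
  have hq0 : 0 < q := one_pos.trans_le hq
  rw [phiFK_eq_sum_phiD w hq0, integral_rcMeasureW_eq_sum _ hq0, integral_rcMeasureW_eq_sum _ hq0]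
  exact sum_phiD_le w hq x Y K hK1 hg

end Summit.CriticalPhenomena.PercolationContinuityZ3.Theorems.FK

end
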